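import Literature.NumberTheory.LFunctions.LogFreeLocalAbstract
import Literature.NumberTheory.LFunctions.ClassGroupLFunctionZeroCount
import Literature.NumberTheory.LFunctions.ClassGroupLFunctionZeroFreeRegion
import Literature.NumberTheory.LFunctions.UniformTwistedLogDerivBound
import Mathlib.Analysis.Complex.JensenFormula
import HarnessLib

/-!
# Local data of the entire class group `L`-function `L₀(s, χ)` on the discs `|s − (2 + iv)| ≤ 2`

Topic `Literature/NumberTheory/LFunctions`, namespace `Literature.NumberTheory.LFunctions.NumberField`.
Everything here is PROVED (theorems only; no named facts).

For a number field `K` of degree `n`, `χ ≠ 1` a class group character and `L₀(s, χ)` the entire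
`L`-function (`classGroupLFunction₀`; `Z₁_χ(s) = (s − 1) L₀(s, χ)`), with `c = 2 + iv` and
`ℒ = discBound K v = log|d_K| + 3n + (n+1) log(|v|+7)`:

* `norm_classGroupLFunction₀_le_of_mem_closedBall` — `|L₀(z)| ≤ B₀ = 2|d_K|e^{2n}(|v|+8)^{n+1}` on
  `|z − c| ≤ 2`; `exp_neg_le_norm_classGroupLFunction₀_two_add` — `|L₀(c)| ≥ e^{−n}/(|v|+1)`;
  `log_supBound₀_div_le` — `log(B₀/|L₀(c)|) ≤ 4ℒ`;
* `sum_discDivisor_classGroupLFunction₀_le` — Jensen: `Σ_{|ρ−c| ≤ 31/16} m(ρ) ≤ 128 ℒ`;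
* `norm_logDeriv_classGroupLFunction₀_sub_sum_le` — the local partial fraction
  `|L₀'/L₀(s) − Σ_{|ρ−c| ≤ 31/16} m(ρ)/(s − ρ)| ≤ 217440 ℒ` for `|s − c| ≤ 7/4`, `L₀(s) ≠ 0`
  (Landau's lemma of the tree, `Literature.Analysis.Complex.norm_logDeriv_sub_sum_le`);
* `norm_logDeriv_classGroupLFunction₀_le` — `|L₀'/L₀(s)| ≤ 1/(σ − 1) + 77760(5n+2)(log|d_K| + log 4)`
  for `1 < σ ≤ 2` (the tree's uniform datum `UniformTwistedZFRData`).

These are the inputs of Bombieri's Lemme de densité / Lemme A for `L₀` (`LogFreeLocalAbstract`).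

## References

* [ThornerZaman2017] J. Thorner, A. Zaman, Algebra Number Theory 11 (2017), §2–§5.
* [Bombieri1987GrandCrible] E. Bombieri, Astérisque 18 (1987), §6.
-/

noncomputable section

open Complex Metric Set Filter Finset MeromorphicOn
open scoped Real Topology

namespace Literature.NumberTheory.LFunctions.NumberField

open Literature.NumberTheory.LFunctions.LogFreeLocal
open scoped nonZeroDivisors _root_.NumberField

variable {K : Type*} [Field K] [NumberField K]

/-! ### `Z₁_χ = (s − 1) L₀` -/

/-- `Z₁_χ(s) = (s − 1) L₀(s, χ)` for `χ ≠ 1` (everywhere). [folklore] -/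
theorem classTwistedZeta₁_apply_eq_sub_one_mul {χ : ClassGroup (𝓞 K) →* ℂˣ} (hχ : χ ≠ 1) (s : ℂ) :
    classTwistedZeta₁ K (fun C ↦ (χ C : ℂ)) s = (s - 1) * classGroupLFunction₀ K χ s := by
  have h := sub_smul_dslope (classTwistedZeta₁ K (fun C ↦ (χ C : ℂ))) 1 s
  rw [smul_eq_mul, classTwistedZeta₁_one_eq_zero hχ, sub_zero] at h
  rw [← h, classGroupLFunction₀]

/-- `L₀ = Z₁/(s − 1)` off `s = 1`. [folklore] -/
theorem classGroupLFunction₀_eq_div {χ : ClassGroup (𝓞 K) →* ℂˣ} (hχ : χ ≠ 1) {s : ℂ} (hs : s ≠ 1) :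
    classGroupLFunction₀ K χ s = classTwistedZeta₁ K (fun C ↦ (χ C : ℂ)) s / (s - 1) := by
  rw [classTwistedZeta₁_apply_eq_sub_one_mul hχ, mul_div_cancel_left₀ _ (sub_ne_zero.mpr hs)]

/-! ### Sup and inf bounds on the disc -/

variable (K) in
/-- The sup bound `B₀ = 2|d_K| e^{2n} (|v| + 8)^{n+1}`. [folklore] -/
def supBound₀ (v : ℝ) : ℝ :=
  2 * ((NumberField.discr K).natAbs : ℝ) * Real.exp (2 * Module.finrank ℚ K) * (|v| + 8) ^ (Module.finrank ℚ K + 1)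

/-- `1 ≤ |d_K|`. [folklore] -/
theorem one_le_natAbs_discr : (1 : ℝ) ≤ ((NumberField.discr K).natAbs : ℝ) := by
  exact_mod_cast Int.natAbs_pos.mpr (NumberField.discr_ne_zero K)

/-- `1 ≤ B₀`. [folklore] -/
theorem one_le_supBound₀ (v : ℝ) : 1 ≤ supBound₀ K v := by
  rw [supBound₀]
  have h1 := one_le_natAbs_discr (K := K)
  have h2 : (1 : ℝ) ≤ Real.exp (2 * Module.finrank ℚ K) := Real.one_le_exp (by positivity)
  have h3 : (1 : ℝ) ≤ (|v| + 8) ^ (Module.finrank ℚ K + 1) := one_le_pow₀ (by linarith [abs_nonneg v])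
  calc (1 : ℝ) ≤ 2 * 1 * 1 * 1 := by norm_num
    _ ≤ _ := by gcongr

/-- **`|L₀(z)| ≤ B₀` on `|z − (2 + iv)| ≤ 2`.** [folklore] -/
theorem norm_classGroupLFunction₀_le_of_mem_closedBall {χ : ClassGroup (𝓞 K) →* ℂˣ} (hχ : χ ≠ 1) (v : ℝ)
    {z : ℂ} (hz : z ∈ closedBall (2 + (v : ℂ) * I) 2) : ‖classGroupLFunction₀ K χ z‖ ≤ supBound₀ K v := by
  have hz' := hz
  rw [mem_closedBall, dist_eq_norm] at hz
  have hre : |z.re - 2| ≤ 2 := by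
    have := abs_re_le_norm (z - (2 + (v : ℂ) * I)); simp at this; linarith
  have him : |z.im - v| ≤ 2 := by
    have := abs_im_le_norm (z - (2 + (v : ℂ) * I)); simp at this; linarith
  have him' : |z.im| + 6 ≤ |v| + 8 := by
    have := abs_sub_abs_le_abs_sub z.im v; linarith
  have hd := one_le_natAbs_discr (K := K)
  by_cases h3 : z.re ≤ 3
  · have h1 : -1 / 2 ≤ z.re := by have := (abs_le.mp hre).1; linarith
    refine (norm_classGroupLFunction₀_le hχ h1 h3).trans ?_
    rw [supBound₀]
    gcongr
  · rw [not_le] at h3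
    have hz1 : z ≠ 1 := fun h ↦ by rw [h, one_re] at h3; norm_num at h3
    rw [classGroupLFunction₀_eq_div hχ hz1, norm_div]
    have hden : (2 : ℝ) ≤ ‖z - 1‖ := by
      have := abs_re_le_norm (z - 1); simp at this
      have h' : 2 ≤ |z.re - 1| := by rw [abs_of_pos (by linarith)]; linarith
      linarith
    have ha : ∀ C, ‖(fun C ↦ ((χ C : ℂˣ) : ℂ)) C‖ ≤ 1 := fun C ↦ (norm_classGroupChar_apply χ C).le
    have hnum := norm_classTwistedZeta₁_le_of_mem_closedBall (K := K) ha v hz'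
    calc ‖classTwistedZeta₁ K (fun C ↦ (χ C : ℂ)) z‖ / ‖z - 1‖
        ≤ (((NumberField.discr K).natAbs : ℝ) * Real.exp (2 * Module.finrank ℚ K) * (|v| + 7) ^ (Module.finrank ℚ K + 1)) / 2 :=
          div_le_div₀ (by positivity) hnum two_pos hden
      _ ≤ supBound₀ K v := by
          rw [supBound₀, div_le_iff₀ two_pos]
          have h78 : (|v| + 7) ^ (Module.finrank ℚ K + 1) ≤ (|v| + 8) ^ (Module.finrank ℚ K + 1) :=
            pow_le_pow_left₀ (by positivity) (by linarith) _
          have hdE : 0 ≤ ((NumberField.discr K).natAbs : ℝ) * Real.exp (2 * Module.finrank ℚ K) := by positivity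
          have := mul_le_mul_of_nonneg_left h78 hdE
          nlinarith [mul_nonneg hdE (by positivity : (0:ℝ) ≤ (|v| + 8) ^ (Module.finrank ℚ K + 1))]

/-- **`|L₀(2 + iv)| ≥ e^{−n}/(|v| + 1)`.** [folklore] -/
theorem exp_neg_le_norm_classGroupLFunction₀_two_add {χ : ClassGroup (𝓞 K) →* ℂˣ} (hχ : χ ≠ 1) (v : ℝ) :
    Real.exp (-(Module.finrank ℚ K : ℝ)) / (|v| + 1) ≤ ‖classGroupLFunction₀ K χ (2 + (v : ℂ) * I)‖ := by
  have hne : (2 + (v : ℂ) * I) ≠ 1 := fun h ↦ by have := congrArg Complex.re h; simp at this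
  rw [classGroupLFunction₀_eq_div hχ hne, norm_div]
  have hden : ‖(2 + (v : ℂ) * I) - 1‖ ≤ |v| + 1 := by
    have : (2 + (v : ℂ) * I) - 1 = 1 + (v : ℂ) * I := by ring
    rw [this]
    refine (norm_add_le _ _).trans ?_
    rw [norm_one, norm_mul, Complex.norm_real, Complex.norm_I, mul_one, Real.norm_eq_abs]; linarith
  have hden0 : 0 < ‖(2 + (v : ℂ) * I) - 1‖ := by
    rw [norm_pos_iff]; exact sub_ne_zero.mpr hne
  have hnum := exp_neg_finrank_le_norm_classTwistedZeta₁_two_add (K := K) χ v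
  exact div_le_div₀ (norm_nonneg _) hnum hden0 hden

/-- `L₀(2 + iv) ≠ 0`. [folklore] -/
theorem classGroupLFunction₀_two_add_ne_zero {χ : ClassGroup (𝓞 K) →* ℂˣ} (hχ : χ ≠ 1) (v : ℝ) :
    classGroupLFunction₀ K χ (2 + (v : ℂ) * I) ≠ 0 := by
  intro h
  have := exp_neg_le_norm_classGroupLFunction₀_two_add hχ v
  rw [h, norm_zero] at this
  have : 0 < Real.exp (-(Module.finrank ℚ K : ℝ)) / (|v| + 1) := by positivity
  linarith

/-- **`log(B₀/|L₀(c)|) ≤ 4ℒ`**, `ℒ = discBound K v`. [folklore] -/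
theorem log_supBound₀_div_le {χ : ClassGroup (𝓞 K) →* ℂˣ} (hχ : χ ≠ 1) (v : ℝ) :
    Real.log (supBound₀ K v / ‖classGroupLFunction₀ K χ (2 + (v : ℂ) * I)‖) ≤ 4 * discBound K v := by
  set n : ℕ := Module.finrank ℚ K with hn
  have hd : (1 : ℝ) ≤ ((NumberField.discr K).natAbs : ℝ) := one_le_natAbs_discr
  have hv0 : 0 ≤ |v| := abs_nonneg v
  have hlow := exp_neg_le_norm_classGroupLFunction₀_two_add hχ v
  have hpos0 : 0 < Real.exp (-(n : ℝ)) / (|v| + 1) := by positivity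
  have hfpos : 0 < ‖classGroupLFunction₀ K χ (2 + (v : ℂ) * I)‖ := hpos0.trans_le hlow
  have hB := one_le_supBound₀ (K := K) v
  -- `log(B₀/|f c|) ≤ log B₀ + n + log(|v|+1)`
  have h1 : Real.log (supBound₀ K v / ‖classGroupLFunction₀ K χ (2 + (v : ℂ) * I)‖) ≤
      Real.log (supBound₀ K v) + (n + Real.log (|v| + 1)) := by
    rw [Real.log_div (by positivity) hfpos.ne']
    have : -Real.log ‖classGroupLFunction₀ K χ (2 + (v : ℂ) * I)‖ ≤ n + Real.log (|v| + 1) := by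
      have h := Real.log_le_log hpos0 hlow
      rw [Real.log_div (Real.exp_pos _).ne' (by positivity), Real.log_exp] at h
      linarith
    linarith
  have h2 : Real.log (supBound₀ K v) = Real.log 2 + Real.log ((NumberField.discr K).natAbs : ℝ) + 2 * n +
      (n + 1) * Real.log (|v| + 8) := by
    rw [supBound₀, Real.log_mul (by positivity) (by positivity), Real.log_mul (by positivity) (by positivity),
      Real.log_mul (by positivity) (by positivity), Real.log_exp, Real.log_pow]
    push_cast; ring
  have hl7 : 1 ≤ Real.log (|v| + 7) := one_le_log_abs_add_seven v
  have hl8 : Real.log (|v| + 8) ≤ Real.log (|v| + 7) + 1 := by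
    have : Real.log (|v| + 8) ≤ Real.log (2 * (|v| + 7)) := Real.log_le_log (by positivity) (by linarith)
    rw [Real.log_mul two_ne_zero (by positivity)] at this
    have hl2 : Real.log 2 ≤ 1 := by
      have := Real.log_two_lt_d9; norm_num at this; linarith
    linarith
  have hl1 : Real.log (|v| + 1) ≤ Real.log (|v| + 7) := Real.log_le_log (by positivity) (by linarith)
  have hl2 : Real.log 2 ≤ 1 := by have := Real.log_two_lt_d9; norm_num at this; linarith
  have hdlog : 0 ≤ Real.log ((NumberField.discr K).natAbs : ℝ) := Real.log_nonneg hd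
  have hnn : (0 : ℝ) ≤ n := Nat.cast_nonneg _
  rw [discBound]
  calc Real.log (supBound₀ K v / ‖classGroupLFunction₀ K χ (2 + (v : ℂ) * I)‖)
      ≤ Real.log 2 + Real.log ((NumberField.discr K).natAbs : ℝ) + 2 * n + (n + 1) * Real.log (|v| + 8) +
          (n + Real.log (|v| + 1)) := by rw [← h2]; exact h1
    _ ≤ 1 + Real.log ((NumberField.discr K).natAbs : ℝ) + 2 * n + (n + 1) * (Real.log (|v| + 7) + 1) +
          (n + Real.log (|v| + 7)) := by nlinarith
    _ ≤ 4 * (Real.log ((NumberField.discr K).natAbs : ℝ) + 3 * n + (n + 1) * Real.log (|v| + 7)) := by nlinarith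

/-! ### Jensen count and the local partial fraction for `L₀` -/

/-- **Jensen: `Σ_{|ρ − c| ≤ 31/16} m(ρ) ≤ 128 ℒ`** for the zeros of `L₀`. [folklore] -/
theorem sum_discDivisor_classGroupLFunction₀_le {χ : ClassGroup (𝓞 K) →* ℂˣ} (hχ : χ ≠ 1) (v : ℝ) :
    ∑ u ∈ discZeros (classGroupLFunction₀ K χ) v, (discDivisor (classGroupLFunction₀ K χ) v u : ℝ) ≤
      128 * discBound K v := by
  set f := classGroupLFunction₀ K χ with hf
  set c : ℂ := 2 + (v : ℂ) * I with hc
  set D := discDivisor f v with hD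
  have hfin : (Function.support D).Finite := D.finiteSupport (isCompact_closedBall _ _)
  have hsum : ∑ u ∈ discZeros f v, (D u : ℝ) = ∑ᶠ u, (D u : ℝ) := by
    rw [finsum_eq_sum_of_support_subset (fun u => (D u : ℝ)) (s := hfin.toFinset) ?_]
    · rfl
    · intro u hu
      simp only [Function.mem_support, ne_eq, Int.cast_eq_zero] at hu
      simp only [Set.Finite.coe_toFinset, Function.mem_support, ne_eq]
      exact hu
  rw [hsum]
  have h1 : 0 < |(31 / 16 : ℝ)| := by norm_num
  have h2 : |(31 / 16 : ℝ)| < |(2 : ℝ)| := by rw [abs_of_pos (by norm_num), abs_of_pos two_pos]; norm_num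
  have h3 : AnalyticOnNhd ℂ f (closedBall c |(2 : ℝ)|) :=
    analyticOnNhd_of_differentiable (differentiable_classGroupLFunction₀ χ) _ _
  have hc0 : f c ≠ 0 := classGroupLFunction₀_two_add_ne_zero hχ v
  have h4 : ∀ z ∈ sphere c |(2 : ℝ)|, ‖f z‖ ≤ supBound₀ K v := by
    intro z hz
    rw [abs_of_pos two_pos] at hz
    exact norm_classGroupLFunction₀_le_of_mem_closedBall hχ v (sphere_subset_closedBall hz)
  have hJ := AnalyticOnNhd.sum_divisor_le h1 h2 (one_le_supBound₀ v) h3 hc0 h4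
  rw [abs_of_pos (by norm_num : (0:ℝ) < 31 / 16)] at hJ
  have hcast : ((∑ᶠ u, divisor f (closedBall c (31 / 16)) u : ℤ) : ℝ) =
      ∑ᶠ u, (divisor f (closedBall c (31 / 16)) u : ℝ) :=
    map_finsum (Int.castRingHom ℝ) ((divisor f (closedBall c (31 / 16))).finiteSupport (isCompact_closedBall _ _))
  have hJ' : ∑ᶠ u, (D u : ℝ) ≤ Real.log (supBound₀ K v / ‖f c‖) / Real.log (2 / (31 / 16)) := by
    rw [hD, discDivisor, ← hcast]; exact_mod_cast hJ
  refine hJ'.trans ?_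
  have hlog : (1 : ℝ) / 32 ≤ Real.log (2 / (31 / 16)) := by
    have := Real.one_sub_inv_le_log_of_pos (by norm_num : (0:ℝ) < 2 / (31 / 16))
    norm_num at this ⊢
    linarith
  have hL := log_supBound₀_div_le hχ v
  have hℒ : 0 ≤ discBound K v := le_trans zero_le_one (one_le_discBound K v)
  have hnum0 : 0 ≤ Real.log (supBound₀ K v / ‖f c‖) := by
    refine Real.log_nonneg ?_
    rw [le_div_iff₀ (norm_pos_iff.mpr hc0), one_mul]
    exact norm_classGroupLFunction₀_le_of_mem_closedBall hχ v (mem_closedBall_self (by norm_num))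
  calc Real.log (supBound₀ K v / ‖f c‖) / Real.log (2 / (31 / 16))
      ≤ Real.log (supBound₀ K v / ‖f c‖) / (1 / 32) := div_le_div_of_nonneg_left hnum0 (by norm_num) hlog
    _ = 32 * Real.log (supBound₀ K v / ‖f c‖) := by ring
    _ ≤ 32 * (4 * discBound K v) := by nlinarith
    _ = 128 * discBound K v := by ring

/-- **The local partial fraction of `L₀'/L₀`, uniformly in `K` and `χ`**: for real `v` and
`|s − (2 + iv)| ≤ 7/4` with `L₀(s) ≠ 0`,
`|L₀'/L₀(s) − Σ_ρ m(ρ)/(s − ρ)| ≤ 217440 ℒ`, the sum over the zeros of `L₀` in `|ρ − (2+iv)| ≤ 31/16`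
(Landau's lemma of the tree, radii `7/4 < 15/8 < 31/16 < 2`). [cite: LagariasOdlyzko1977, Lemma 5.6] -/
theorem norm_logDeriv_classGroupLFunction₀_sub_sum_le {χ : ClassGroup (𝓞 K) →* ℂˣ} (hχ : χ ≠ 1) (v : ℝ)
    {s : ℂ} (hs : s ∈ closedBall (2 + (v : ℂ) * I) (7 / 4)) (hfs : classGroupLFunction₀ K χ s ≠ 0) :
    ‖logDeriv (classGroupLFunction₀ K χ) s -
        ∑ u ∈ discZeros (classGroupLFunction₀ K χ) v,
          (discDivisor (classGroupLFunction₀ K χ) v u : ℂ) / (s - u)‖ ≤ 217440 * discBound K v := by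
  set f := classGroupLFunction₀ K χ with hf
  set c : ℂ := 2 + (v : ℂ) * I with hc
  have hc0 : f c ≠ 0 := classGroupLFunction₀_two_add_ne_zero hχ v
  have hℒ1 : 1 ≤ discBound K v := one_le_discBound K v
  have h := Literature.Analysis.Complex.norm_logDeriv_sub_sum_le (f := f) (c := c)
    (r := 7 / 4) (r₁ := 15 / 8) (R₂ := 31 / 16) (R := 2) (B := supBound₀ K v)
    (by norm_num) (by norm_num) (by norm_num) (by norm_num)
    (analyticOnNhd_of_differentiable (differentiable_classGroupLFunction₀ χ) _ _) hc0
    (fun z hz ↦ norm_classGroupLFunction₀_le_of_mem_closedBall hχ v hz) hs hfs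
  have hSeq : ((divisor f (closedBall c (31 / 16))).finiteSupport (isCompact_closedBall c (31 / 16))).toFinset =
      discZeros f v := rfl
  have hDeq : divisor f (closedBall c (31 / 16)) = discDivisor f v := rfl
  rw [hSeq, hDeq] at h
  refine h.trans ?_
  have hJ := sum_discDivisor_classGroupLFunction₀_le hχ v
  have hL := log_supBound₀_div_le hχ v
  have hlog32 : Real.log (2 / (2 - 31 / 16)) ≤ 7 / 2 := by
    rw [show (2 : ℝ) / (2 - 31 / 16) = 32 by norm_num, show (32 : ℝ) = 2 ^ 5 by norm_num, Real.log_pow]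
    have := Real.log_two_lt_d9; norm_num at this ⊢; linarith
  have hsum0 : 0 ≤ ∑ u ∈ discZeros f v, (discDivisor f v u : ℝ) :=
    Finset.sum_nonneg fun u _ ↦ by exact_mod_cast discDivisor_nonneg (differentiable_classGroupLFunction₀ χ) v u
  have hcoef : (2 : ℝ) * (15 / 8) / ((31 / 16 - 15 / 8) * (15 / 8 - 7 / 4)) = 480 := by norm_num
  rw [hcoef]
  calc 480 * (Real.log (supBound₀ K v / ‖f c‖) +
        (∑ u ∈ discZeros f v, (discDivisor f v u : ℝ)) * Real.log (2 / (2 - 31 / 16)) + 1)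
      ≤ 480 * (4 * discBound K v + 128 * discBound K v * (7 / 2) + discBound K v) := by
        gcongr
    _ = 217440 * discBound K v := by ring

/-! ### The logarithmic derivative to the right of `σ = 1` -/

/-- **`|L₀'/L₀(s)| ≤ 1/(σ − 1) + 77760(5n + 2)(log|d_K| + log 4)`** for `1 < σ ≤ 2` (the uniform
datum of the tree, `UniformTwistedZFRData.norm_logDeriv_le_of_one_lt_re`). [cite: ThornerZaman2019, Theorem 3.1] -/
theorem norm_logDeriv_classGroupLFunction₀_le {χ : ClassGroup (𝓞 K) →* ℂˣ} (hχ : χ ≠ 1) {s : ℂ}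
    (hs : 1 < s.re) (hs2 : s.re ≤ 2) :
    ‖logDeriv (classGroupLFunction₀ K χ) s‖ ≤
      1 / (s.re - 1) + 77760 * (5 * Module.finrank ℚ K + 2) *
        (Real.log ((NumberField.discr K).natAbs : ℝ) + Real.log 4) := by
  rw [logDeriv_apply]
  by_cases h2 : χ * χ = 1
  · have hdat := uniformTwistedZFRData_classGroupLFunction₀_of_eq hχ h2
    have h := hdat.norm_logDeriv_le_of_one_lt_re s hs
    rw [min_eq_left hs2] at h
    exact_mod_cast h
  · have hdat := uniformTwistedZFRData_classGroupLFunction₀_of_ne h2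
    have h := hdat.norm_logDeriv_le_of_one_lt_re s hs
    rw [min_eq_left hs2] at h
    exact_mod_cast h

/-- `log|d_K| + log 4 ≤ ℒ`. [folklore] -/
theorem log_discr_add_log_four_le_discBound (v : ℝ) :
    Real.log ((NumberField.discr K).natAbs : ℝ) + Real.log 4 ≤ discBound K v := by
  rw [discBound]
  have h1 : (1 : ℝ) ≤ Module.finrank ℚ K := by exact_mod_cast Module.finrank_pos (R := ℚ) (M := K)
  have h4 : Real.log 4 ≤ 3 := by
    rw [show (4 : ℝ) = 2 ^ 2 by norm_num, Real.log_pow]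
    have := Real.log_two_lt_d9; norm_num at this ⊢; linarith
  have h7 : 0 ≤ ((Module.finrank ℚ K : ℝ) + 1) * Real.log (|v| + 7) := by
    have := one_le_log_abs_add_seven v; positivity
  linarith

end Literature.NumberTheory.LFunctions.NumberField

end
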